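import Summits.MatrixMultiplication.MatrixMultiplication.Theorems.AbelianSTPPCensusTC3StatDefs

/-!
# T_C static certificate, range `3004 … 3192` (t*-indexed linear checker with the k-member tree at `τ = 12/5`): kernel evaluation, the shape checks of the tree-heavy volumes `1890` on the order sub-range(s) `3004 … 3100`, `3101 … 3150`, `3151 … 3192` (one theorem per (volume, sub-range): bounded kernel memory)

Cell mm-stpp (rung F-M1), tier T_C = «beat `2.4`»; checker in `AbelianSTPPCensusTC3StatDefs.lean`, table and bucket lists in `AbelianSTPPCensusTC3StatData.lean`
(pattern: theory g12's `AbelianSTPPCensusTAStatDDom*/DCk*.lean`).  `decide` with kernel reduction (standard axioms; no `native_decide`), `Elab.async false`;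
consumed by `TC3Stat.checkV_sound` / `TC3Stat.domV_sound` / `TC3Stat.m2V_sound` in the leaf `AbelianSTPPCensusLeafTC3192Closed.lean`.
WHAT THIS IS NOT: arithmetic on shape lists only; no statement about STPP families or `ω`.
-/

set_option linter.dupNamespace false
set_option autoImplicit false
set_option Elab.async false

namespace Summit.MatrixMultiplication.MatrixMultiplication.Theorems.TC3Stat

set_option maxHeartbeats 0 in
/-- Heavy volume `1890` (45 shapes; 57068 tree nodes over all orders), orders `3004 … 3100`: every sorted candidate shape passes `checkShape 3004 3100`. [original] -/
theorem ck1890r0 : TC3Stat.checkV 3004 3100 1 1890 = true := by decide +kernel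

set_option maxHeartbeats 0 in
/-- Heavy volume `1890` (45 shapes; 57068 tree nodes over all orders), orders `3101 … 3150`: every sorted candidate shape passes `checkShape 3101 3150`. [original] -/
theorem ck1890r1 : TC3Stat.checkV 3101 3150 1 1890 = true := by decide +kernel

set_option maxHeartbeats 0 in
/-- Heavy volume `1890` (45 shapes; 57068 tree nodes over all orders), orders `3151 … 3192`: every sorted candidate shape passes `checkShape 3151 3192`. [original] -/
theorem ck1890r2 : TC3Stat.checkV 3151 3192 1 1890 = true := by decide +kernel

end Summit.MatrixMultiplication.MatrixMultiplication.Theorems.TC3Stat
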